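import Summits.Ventures.HodgeRepro2.T5SL2Unimodular
import Mathlib.NumberTheory.Padics.ProperSpace

/-!
# `SL₂` over a locally compact field of characteristic zero is unimodular

`T5SL2Unimodular.modularCharacterFun_eq_one` needs an element `a ≠ 0` with `a² ≠ 1`; in
characteristic zero `a = 2` works.  Instantiations: `SL₂(ℂ)` and `SL₂(ℚ_p)` (Mathlib:
`ProperSpace ℚ_[p]`), the latter being the support map's «a reductive `p`-adic group is
unimodular» (B1) at `SL₂`.

Blind lane: Mathlib + own prefix only; no sorry; axioms ⊆ {propext, Classical.choice, Quot.sound}.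
-/

namespace Summit.Ventures.HodgeRepro2.T5SL2LocalFieldUnimodular

open MeasureTheory MeasureTheory.Measure Matrix

section charZero

variable {F : Type*} [Field F] [TopologicalSpace F] [IsTopologicalRing F] [T2Space F]
  [LocallyCompactSpace F] [CharZero F]

/-- The modular character of `SL₂(F)` is trivial for every locally compact Hausdorff field `F` of
characteristic zero. -/
theorem modularCharacterFun_eq_one (g : SpecialLinearGroup (Fin 2) F) : modularCharacterFun g = 1 :=
  T5SL2Unimodular.modularCharacterFun_eq_one (2 : F) two_ne_zero (by norm_num) g

/-- Every inner regular left Haar measure on `SL₂(F)` is right-invariant (`F` locally compact of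
characteristic zero). -/
theorem isMulRightInvariant [MeasurableSpace (SpecialLinearGroup (Fin 2) F)]
    [BorelSpace (SpecialLinearGroup (Fin 2) F)] (μ : Measure (SpecialLinearGroup (Fin 2) F))
    [IsHaarMeasure μ] [InnerRegular μ] : IsMulRightInvariant μ :=
  T5SL2Unimodular.isMulRightInvariant (2 : F) two_ne_zero (by norm_num) μ

/-- Every inner regular left Haar measure on `SL₂(F)` is inversion-invariant. -/
theorem isInvInvariant [MeasurableSpace (SpecialLinearGroup (Fin 2) F)]
    [BorelSpace (SpecialLinearGroup (Fin 2) F)] (μ : Measure (SpecialLinearGroup (Fin 2) F))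
    [IsHaarMeasure μ] [InnerRegular μ] : IsInvInvariant μ :=
  T5SL2Unimodular.isInvInvariant (2 : F) two_ne_zero (by norm_num) μ

end charZero

section complex

/-- The modular character of `SL₂(ℂ)` is trivial. -/
theorem modularCharacterFun_eq_one_complex (g : SpecialLinearGroup (Fin 2) ℂ) :
    modularCharacterFun g = 1 :=
  modularCharacterFun_eq_one g

/-- Every left Haar measure on `SL₂(ℂ)` is right-invariant (second countable: no regularity
hypothesis). -/
theorem isMulRightInvariant_complex [MeasurableSpace (SpecialLinearGroup (Fin 2) ℂ)]
    [BorelSpace (SpecialLinearGroup (Fin 2) ℂ)] (μ : Measure (SpecialLinearGroup (Fin 2) ℂ))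
    [IsHaarMeasure μ] : IsMulRightInvariant μ :=
  T5UnimodularPerfect.isMulRightInvariant_of_commutator_eq_top_of_secondCountable
    T5SL2Perfect.commutator_eq_top_of_charZero μ

end complex

section padic

variable (p : ℕ) [Fact p.Prime]

/-- **`SL₂(ℚ_p)` has trivial modular character** — «a reductive `p`-adic group is unimodular»
at `SL₂` (`ℚ_p` is a proper, hence locally compact, field of characteristic zero). -/
theorem modularCharacterFun_eq_one_padic (g : SpecialLinearGroup (Fin 2) ℚ_[p]) :
    modularCharacterFun g = 1 :=
  modularCharacterFun_eq_one g

/-- Every inner regular left Haar measure on `SL₂(ℚ_p)` is right-invariant. -/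
theorem isMulRightInvariant_padic [MeasurableSpace (SpecialLinearGroup (Fin 2) ℚ_[p])]
    [BorelSpace (SpecialLinearGroup (Fin 2) ℚ_[p])] (μ : Measure (SpecialLinearGroup (Fin 2) ℚ_[p]))
    [IsHaarMeasure μ] [InnerRegular μ] : IsMulRightInvariant μ :=
  isMulRightInvariant μ

/-- Every inner regular left Haar measure on `SL₂(ℚ_p)` is inversion-invariant. -/
theorem isInvInvariant_padic [MeasurableSpace (SpecialLinearGroup (Fin 2) ℚ_[p])]
    [BorelSpace (SpecialLinearGroup (Fin 2) ℚ_[p])] (μ : Measure (SpecialLinearGroup (Fin 2) ℚ_[p]))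
    [IsHaarMeasure μ] [InnerRegular μ] : IsInvInvariant μ :=
  isInvInvariant μ

end padic

end Summit.Ventures.HodgeRepro2.T5SL2LocalFieldUnimodular
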